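import Summits.QuantumFields.YangMills.Theorems.BalabanUVNodesN12RootedForest
import Literature.MathematicalPhysics.QuantumFieldTheory.Balaban1983to89.B16Sect1Backgrounds
import Literature.MathematicalPhysics.QuantumFieldTheory.Balaban1983to89.B14Eq16FaddeevPopov
import Literature.MathematicalPhysics.QuantumFieldTheory.Balaban1983to89.T3DescentFibreTower
import Literature.MathematicalPhysics.QuantumFieldTheory.Balaban1983to89.Node00.DatumAvLayer
import HarnessLib

/-!
# BalabanUVNodes ∕ N12 — THE (T1@q₀)-CENTRAL LETTER OF THE w1 LINEAGE AT THE FLAT DATUM: THE TWIST OBSTRUCTION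
# (a located TIGHTNESS lemma: the letter is satisfiable at a reducible base datum ONLY IF the tower-site constraint graph is connected)
# ([Balaban1985Variational] Thm 1 p. 279 «a unique critical orbit in the space (6)», (3)–(4) p. 278; [Balaban1985Averaging] (8), (11) pp. 18–19; [Balaban1988Convergent] (2.2), (2.10)–(2.12) pp. 255–256)

Cell `pub-ymgap` (HUMAN RULINGS D-0062 ∕ D-0149), WIDTH SEAT `pub-ymgap-dag-n12-w1` g4 (node N12 = [B15]; key K1⁹ `stmt-QuantumFields-27364`, `--kind proof --supports … --as helper`;
count-neutral).  THEOREMS ONLY (0 `def`, 0 `instance`, 0 `sorry`); consumed BY NAME: r13's `B16Sect1Backgrounds` (`toMS`, `iter_gaugeAct`, `gaugeAct_gaugeAct`, `mulG`), the gauge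
invariance of the Wilson action (`B14Eq16FaddeevPopov.wilsonAction4_gaugeAct'`), the 3D programme's `T3DescentFibreTower.avgFun_one` (the averaging of record fixes `1`), and dag-n12-w3's
BFS forest `…N12RootedForest.exists_rootedForest` (connectivity of the fine torus: every site hangs off a single root).

WHY (a self-audit of the lineage's displayed letter, numbers not adjectives).  The chart theorems of the w1 lineage (g3 `…MinimiserFamilyFromThm1AtBaseCentral`, `…RightInverseLetterOfForest`;
g4 `…MinimiserFamilyAtRecordBj`) display per base field the letter (T1@q₀)-CENTRAL: every class member with the base datum on `𝐁` and no larger action is `U₀^{u⁻¹}` for a gauge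
transformation `u` whose tower restrictions `toMS u j` are CENTRAL and EQUAL at the two tower sites of every constrained bond (g3's LOCATED-2 repair of the residual reading).  At a
REDUCIBLE base datum this letter has a combinatorial precondition.  Let 𝒢 be the tower-site constraint graph (vertices `embIter j c₋`, `embIter j c₊` of the constrained bonds `c`,
edges the constrained bonds) and `T` a set of fine sites CLOSED under 𝒢's edges (for every constrained `c`: `embIter j c₋ ∈ T ↔ embIter j c₊ ∈ T`, i.e. a union of components).  The
TWIST `v := g₀` on `T`, `1` elsewhere, maps the flat configuration `1` to `1^v` with the SAME multi-scale datum on `𝐁` (exact covariance (11) of the averaging + `Ū(1) = 1`) and the same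
action; and `1^v` is tower-central-gauge-related to `1` only if `g₀` commutes with everything — UNLESS `T` contains every tower site or none.  Hence: if 𝒢 is DISCONNECTED (some `T` as
above contains one tower site and misses another), the (T1@q₀)-central clause FAILS at the flat base datum (`U₀ = 1`, `W = Ū(1)`), for every reading class containing `1^v`.  At the
record (`𝐁 = 𝐁_k(Z)`, `{Ω_n}` maximal) 𝒢 is plausibly CONNECTED (levels glue along `∂Ω_j`: a level-`j` constrained bond sticking out of `Ω_j` ends at the centre of a `Γ_{j−1}`-cube) —
NOT proved here; this file types the obstruction so that the letter's inhabitability at reducible data is pinned to exactly that combinatorial fact (HOME memo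
`pub-ymgap-dag-n12-w1/LOCATED-3-T1-CENTRAL-AT-REDUCIBLE-DATA.md`).

CONTENTS (generic torus `P`, `SU(N)`, the averaging of record `Node00.avOfRecord`).  §1 `iter_avOfRecord_one'` (`Ū^j(1) = 1`), `avgFamily_gaugeAct_apply` (covariance at one bond),
`eq_of_gaugeAct_one_eq_one` (a gauge transformation fixing the flat configuration is constant — torus connectivity via the BFS forest); §2 ★★ `twist_agreeOn_one` (the twisted flat
configuration has the flat datum on `𝐁`), `twist_wilsonAction4` (same action); §3 ★★★ `not_exists_central_gauge_of_twist` (no tower-central `u` maps `1^v` back to `1` when `T` separates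
two tower sites and `g₀` is non-central), ★★★ `not_T1central_flat_of_disconnected` (the (T1@q₀)-central clause at the flat datum is FALSE for every reading class containing `1^v`).

HONEST FRAMING.  A conditional NEGATIVE (tightness) lemma about a DISPLAYED letter of this seat's own lineage, not about any route statement; its precondition (a disconnected
tower-site graph) is NOT claimed to hold at the record — the opposite is expected; nothing of Bałaban's asserted; N12 NOT discharged; K1⁹ NOT closed; counts unmoved; one finite 𝕋⁴
programme at fixed ε — R4 closes the conditional rung `BalabanLadder.UV` only; the Yang–Mills mass gap (Clay) is NOT proved by any of this; nothing continuum ∕ ℝ⁴ ∕ OS.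
-/

noncomputable section

namespace Summit.QuantumFields.YangMills.BalabanUVNodes.N12Thm1CentralLetterTwistObstruction

open Set
open Literature.MathematicalPhysics.QuantumFieldTheory.Balaban1983to89
open Literature.MathematicalPhysics.QuantumFieldTheory.Balaban1983to89.T4Continuum (T4Family LStep)
open Literature.MathematicalPhysics.QuantumFieldTheory.Balaban1983to89.Node00 (avOfRecord SU avOfRecord_avg)
open Literature.MathematicalPhysics.QuantumFieldTheory.Balaban1983to89.B15DeterminingSets (DetSet MSField AgreeOn avgFamily bondsOf embIter)
open Literature.MathematicalPhysics.QuantumFieldTheory.Balaban1983to89.B16Sect1Backgrounds (toMS iter_gaugeAct gaugeAct_gaugeAct mulG)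
open Literature.MathematicalPhysics.QuantumFieldTheory.Balaban1983to89.GaugeField (gaugeAct)
open Summit.QuantumFields.YangMills.BalabanUVNodes.N12RootedForest (exists_rootedForest)

variable {F : T4Family} {N : ℕ} [NeZero N] {K : ℕ}

/-! ## §1  Three bookkeeping facts: `Ū(1) = 1`, covariance at one bond, and «fixing `1` ⇒ constant» -/

/-- The averaging of record fixes the flat configuration at every level (`T3DescentFibreTower.avgFun_one`; twin of `B15Claim189UnitTestAtRecord.iter_avOfRecord_one`, stated here to
keep the import light). [cite: Balaban1987RG1, (0.4) p.253 (bookkeeping)] -/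
theorem iter_avOfRecord_one' : ∀ j : ℕ, Averaging.iter (avOfRecord F N K) j (1 : GaugeField (F.P K) 0 (SU N)) = 1
  | 0 => rfl
  | j + 1 => by
    show (avOfRecord F N K j).avg (Averaging.iter (avOfRecord F N K) j 1) = 1
    rw [iter_avOfRecord_one' j, avOfRecord_avg]
    exact T3DescentFibreTower.avgFun_one _ T3DescentFibreTower.expMeanLogSU_E_one

/-- **COVARIANCE (11) AT ONE BOND**, standing range: `Ū^j(U^v)(b) = v(ι_j b₋)·Ū^j(U)(b)·v(ι_j b₊)⁻¹`. [cite: Balaban1985Averaging, (11) p.19] -/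
theorem avgFamily_gaugeAct_apply {j : ℕ} (hj : j ≤ (F.P K).m + (F.P K).K) (v : GaugeTransf (F.P K) 0 (SU N)) (U : GaugeField (F.P K) 0 (SU N))
    (b : PBond (F.P K) j) :
    avgFamily (avOfRecord F N K) (gaugeAct v U) j b = v (embIter j b.src) * avgFamily (avOfRecord F N K) U j b * (v (embIter j b.tgt))⁻¹ := by
  show Averaging.iter (avOfRecord F N K) j (gaugeAct v U) b = _
  rw [iter_gaugeAct (avOfRecord F N K) v U j hj]
  rfl

/-- **A GAUGE TRANSFORMATION FIXING THE FLAT CONFIGURATION IS CONSTANT** (the fine torus is connected: dag-n12-w3's BFS forest from a single root reaches every site).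
[cite: Balaban1985Averaging, (8) p.18; Balaban1987RG1, (0.1) p.251 (bookkeeping)] -/
theorem eq_of_gaugeAct_one_eq_one {P : Params} {G : Type*} [GaugeGroup G] {w : GaugeTransf P 0 G}
    (hw : gaugeAct w (1 : GaugeField P 0 G) = 1) (x y : Site P 0) : w x = w y := by
  -- along every bond `w` agrees at the two ends
  have hbond : ∀ b : PBond P 0, w b.src = w b.tgt := fun b => by
    have h := congrFun hw b
    have h1 : (1 : GaugeField P 0 G) b = 1 := rfl
    simp only [gaugeAct, GaugeField.gaugeAct, h1, mul_one] at h
    exact mul_inv_eq_one.mp h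
  -- BFS forest rooted at `y`: every site hangs off `y`
  obtain ⟨path, hroot, htree⟩ := exists_rootedForest ({y} : Set (Site P 0)) (Set.singleton_nonempty y)
  suffices key : ∀ n : ℕ, ∀ z : Site P 0, (path z).length = n → w z = w y from key _ x rfl
  intro n
  induction n using Nat.strong_induction_on with
  | _ n ih =>
    intro z hz
    by_cases hzy : z ∈ ({y} : Set (Site P 0))
    · rw [Set.mem_singleton_iff.mp hzy]
    · obtain ⟨z', s, hpath, hfwd, hbwd⟩ := htree z hzy
      have hlt : (path z').length < n := by rw [← hz, hpath, List.length_append, List.length_singleton]; omega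
      have hz' := ih _ hlt z' rfl
      rcases Bool.eq_false_or_eq_true s.fwd with hs | hs
      · obtain ⟨h1, h2⟩ := hfwd hs
        rw [← hz', ← h1, ← h2]; exact (hbond s.bond).symm
      · obtain ⟨h1, h2⟩ := hbwd hs
        rw [← hz', ← h1, ← h2]; exact hbond s.bond

/-! ## §2  The twist: same datum, same action -/

/-- ★★ **THE TWISTED FLAT CONFIGURATION HAS THE FLAT DATUM ON `𝐁`**: for a set `T` of fine sites closed under the constrained bonds (a union of components of the tower-site graph) and
the twist `v = g₀` on `T`, `1` elsewhere, `Ū(1^v) = Ū(1)` on every constrained bond (standing range): both tower sites carry the same value of `v`, and `Ū(1) = 1` commutes with it.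
[cite: Balaban1985Averaging, (11) p.19; Balaban1988Convergent, (2.2) p.255, (2.10) p.256] -/
theorem twist_agreeOn_one (𝔹 : DetSet (F.P K)) (h𝔹 : ∀ j, (F.P K).m + (F.P K).K < j → 𝔹 j = ∅)
    (T : Set (Site (F.P K) 0)) [DecidablePred (· ∈ T)]
    (hT : ∀ j, j ≤ (F.P K).m + (F.P K).K → ∀ c ∈ bondsOf (𝔹 j), (embIter j c.src ∈ T ↔ embIter j c.tgt ∈ T)) (g₀ : SU N) :
    AgreeOn 𝔹 (avgFamily (avOfRecord F N K) (gaugeAct (fun x => if x ∈ T then g₀ else 1) 1)) (avgFamily (avOfRecord F N K) 1) := by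
  intro j c hc
  by_cases hj : j ≤ (F.P K).m + (F.P K).K
  · rw [avgFamily_gaugeAct_apply hj]
    have h1 : avgFamily (avOfRecord F N K) (1 : GaugeField (F.P K) 0 (SU N)) j c = 1 := by
      show Averaging.iter (avOfRecord F N K) j 1 c = 1
      rw [iter_avOfRecord_one']; rfl
    rw [h1]
    by_cases hs : embIter j c.src ∈ T
    · have ht : embIter j c.tgt ∈ T := (hT j hj c hc).1 hs
      simp [hs, ht]
    · have ht : embIter j c.tgt ∉ T := fun h => hs ((hT j hj c hc).2 h)
      simp [hs, ht]
  · exfalso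
    rw [h𝔹 j (not_le.mp hj)] at hc
    simp [bondsOf] at hc

/-- The twisted flat configuration has the flat action (gauge invariance of the Wilson action). [cite: Balaban1988Convergent, (0.2) p.244] -/
theorem twist_wilsonAction4 (v : GaugeTransf (F.P K) 0 (SU N)) :
    wilsonAction4 (gaugeAct v (1 : GaugeField (F.P K) 0 (SU N))) = wilsonAction4 (1 : GaugeField (F.P K) 0 (SU N)) :=
  B14Eq16FaddeevPopov.wilsonAction4_gaugeAct' v 1

/-! ## §3  The obstruction -/

/-- ★★★ **NO TOWER-CENTRAL GAUGE TRANSFORMATION MAPS THE TWISTED FLAT CONFIGURATION BACK TO `1`** when `T` contains the tower site `embIter j₁ c₁₋` of one constrained bond, misses the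
tower site `embIter j₂ c₂₋` of another, and `g₀` is non-central: `u` with `(1^v)^u = 1` has `u·v` constant (`eq_of_gaugeAct_one_eq_one`), so `u = c·g₀⁻¹` at the first site and `u = c`
at the second; both central forces `g₀` central. [cite: Balaban1985Variational, Thm 1 p.279, (4) p.278; Balaban1985Averaging, (8) p.18] -/
theorem not_exists_central_gauge_of_twist {k : ℕ} (𝔹 : DetSet (F.P K)) (T : Set (Site (F.P K) 0)) [DecidablePred (· ∈ T)]
    {j₁ : ℕ} (hj₁ : j₁ ≤ k) {c₁ : PBond (F.P K) j₁} (hc₁ : c₁ ∈ bondsOf (𝔹 j₁)) (hz₁ : embIter j₁ c₁.src ∈ T)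
    {j₂ : ℕ} (hj₂ : j₂ ≤ k) {c₂ : PBond (F.P K) j₂} (hc₂ : c₂ ∈ bondsOf (𝔹 j₂)) (hz₂ : embIter j₂ c₂.src ∉ T)
    {g₀ : SU N} (hg₀ : ∃ h : SU N, g₀ * h ≠ h * g₀) :
    ¬ ∃ u : GaugeTransf (F.P K) 0 (SU N),
      (∀ j, j ≤ k → ∀ b ∈ bondsOf (𝔹 j), toMS u j b.src = toMS u j b.tgt ∧ ∀ g : SU N, toMS u j b.src * g = g * toMS u j b.src) ∧
      gaugeAct u (gaugeAct (fun x => if x ∈ T then g₀ else 1) (1 : GaugeField (F.P K) 0 (SU N))) = 1 := by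
  rintro ⟨u, hcen, hu⟩
  rw [gaugeAct_gaugeAct] at hu
  -- `u·v` is constant
  have hconst := eq_of_gaugeAct_one_eq_one hu (embIter j₁ c₁.src) (embIter j₂ c₂.src)
  simp only [mulG, hz₁, hz₂, if_true, if_false, mul_one] at hconst
  -- centrality at the two tower sites
  have hc1 : ∀ g : SU N, u (embIter j₁ c₁.src) * g = g * u (embIter j₁ c₁.src) := (hcen j₁ hj₁ c₁ hc₁).2
  have hc2 : ∀ g : SU N, u (embIter j₂ c₂.src) * g = g * u (embIter j₂ c₂.src) := (hcen j₂ hj₂ c₂ hc₂).2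
  obtain ⟨h, hh⟩ := hg₀
  apply hh
  -- `g₀ = u(z₂)⁻¹ · u(z₂) · g₀`… : write `g₀ = (u z₁)⁻¹ * u z₂` from `u z₁ * g₀ = u z₂`
  have hg : g₀ = (u (embIter j₁ c₁.src))⁻¹ * u (embIter j₂ c₂.src) := by
    rw [← hconst, ← mul_assoc, inv_mul_cancel, one_mul]
  have hinv1 : ∀ g : SU N, (u (embIter j₁ c₁.src))⁻¹ * g = g * (u (embIter j₁ c₁.src))⁻¹ := fun g => by
    have e := hc1 (g)
    -- conjugate the centrality of `u z₁`
    calc (u (embIter j₁ c₁.src))⁻¹ * g = (u (embIter j₁ c₁.src))⁻¹ * g * (u (embIter j₁ c₁.src) * (u (embIter j₁ c₁.src))⁻¹) := by group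
      _ = (u (embIter j₁ c₁.src))⁻¹ * (g * u (embIter j₁ c₁.src)) * (u (embIter j₁ c₁.src))⁻¹ := by group
      _ = (u (embIter j₁ c₁.src))⁻¹ * (u (embIter j₁ c₁.src) * g) * (u (embIter j₁ c₁.src))⁻¹ := by rw [e]
      _ = g * (u (embIter j₁ c₁.src))⁻¹ := by group
  calc g₀ * h = (u (embIter j₁ c₁.src))⁻¹ * u (embIter j₂ c₂.src) * h := by rw [hg]
    _ = (u (embIter j₁ c₁.src))⁻¹ * (u (embIter j₂ c₂.src) * h) := by rw [mul_assoc]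
    _ = (u (embIter j₁ c₁.src))⁻¹ * (h * u (embIter j₂ c₂.src)) := by rw [hc2 h]
    _ = ((u (embIter j₁ c₁.src))⁻¹ * h) * u (embIter j₂ c₂.src) := by rw [mul_assoc]
    _ = (h * (u (embIter j₁ c₁.src))⁻¹) * u (embIter j₂ c₂.src) := by rw [hinv1 h]
    _ = h * ((u (embIter j₁ c₁.src))⁻¹ * u (embIter j₂ c₂.src)) := by rw [mul_assoc]
    _ = h * g₀ := by rw [← hg]

/-- ★★★ **THE (T1@q₀)-CENTRAL CLAUSE FAILS AT THE FLAT BASE DATUM WHEN THE TOWER-SITE GRAPH IS DISCONNECTED.**  With `T` a union of components of the tower-site constraint graph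
separating two tower sites, `g₀` non-central, `U₀ := 1`, `W := Ū(1)`, and ANY reading class `reg'` containing the twisted configuration `1^v`, the clause
«`∀ U ∈ reg'`, datum `W` on `𝐁` ∧ `A(U) ≤ A(1)` ⇒ `∃ u` tower-central with `U^u = 1`» is FALSE — the located precondition of the w1 lineage's letter at reducible data.
[cite: Balaban1985Variational, Thm 1 p.279, (3)–(4) p.278; Balaban1985Averaging, (8), (11) pp.18–19; Balaban1988Convergent, (2.2) p.255, (2.10)–(2.12) p.256] -/
theorem not_T1central_flat_of_disconnected {k : ℕ} (hk : k ≤ (F.P K).m + (F.P K).K) (𝔹 : DetSet (F.P K)) (h𝔹 : ∀ j, k < j → 𝔹 j = ∅)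
    (T : Set (Site (F.P K) 0)) [DecidablePred (· ∈ T)]
    (hT : ∀ j, j ≤ k → ∀ c ∈ bondsOf (𝔹 j), (embIter j c.src ∈ T ↔ embIter j c.tgt ∈ T))
    {j₁ : ℕ} (hj₁ : j₁ ≤ k) {c₁ : PBond (F.P K) j₁} (hc₁ : c₁ ∈ bondsOf (𝔹 j₁)) (hz₁ : embIter j₁ c₁.src ∈ T)
    {j₂ : ℕ} (hj₂ : j₂ ≤ k) {c₂ : PBond (F.P K) j₂} (hc₂ : c₂ ∈ bondsOf (𝔹 j₂)) (hz₂ : embIter j₂ c₂.src ∉ T)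
    {g₀ : SU N} (hg₀ : ∃ h : SU N, g₀ * h ≠ h * g₀)
    (reg' : Set (GaugeField (F.P K) 0 (SU N))) (hmem : gaugeAct (fun x => if x ∈ T then g₀ else 1) (1 : GaugeField (F.P K) 0 (SU N)) ∈ reg') :
    ¬ (∀ U ∈ reg', AgreeOn 𝔹 (avgFamily (avOfRecord F N K) U) (avgFamily (avOfRecord F N K) 1) →
        wilsonAction4 U ≤ wilsonAction4 (1 : GaugeField (F.P K) 0 (SU N)) →
          ∃ u : GaugeTransf (F.P K) 0 (SU N), (∀ j, j ≤ k → ∀ b ∈ bondsOf (𝔹 j),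
            toMS u j b.src = toMS u j b.tgt ∧ ∀ g : SU N, toMS u j b.src * g = g * toMS u j b.src) ∧ gaugeAct u U = 1) := by
  intro hT1
  have h𝔹' : ∀ j, (F.P K).m + (F.P K).K < j → 𝔹 j = ∅ := fun j hj => h𝔹 j (lt_of_le_of_lt hk hj)
  have hT' : ∀ j, j ≤ (F.P K).m + (F.P K).K → ∀ c ∈ bondsOf (𝔹 j), (embIter j c.src ∈ T ↔ embIter j c.tgt ∈ T) := by
    intro j hj c hc
    by_cases hjk : j ≤ k
    · exact hT j hjk c hc
    · exfalso; rw [h𝔹 j (not_le.mp hjk)] at hc; simp [bondsOf] at hc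
  exact not_exists_central_gauge_of_twist 𝔹 T hj₁ hc₁ hz₁ hj₂ hc₂ hz₂ hg₀
    (hT1 _ hmem (twist_agreeOn_one 𝔹 h𝔹' T hT' g₀) (twist_wilsonAction4 _).le)

end Summit.QuantumFields.YangMills.BalabanUVNodes.N12Thm1CentralLetterTwistObstruction

end
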